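import Mathlib.RingTheory.Coprime.Basic
import Mathlib.Algebra.Group.Int.Units
import Mathlib.Algebra.Ring.Int.Parity
import Mathlib.Tactic.Ring

/-!
# Route LinearSystemTorelli — crux `LocalTubeSpan` (stmt-HodgeConjecture-2490): the Euclid game

Helper file (`--supports stmt-HodgeConjecture-2490`, line `Sketch` of the crux chain, cycle 7, lead c6:
"the Euclid game — arithmetic input of the unimodular transitivity of the level-2 elementary moves
(squares of transvections change `(A, β)` by `β ↦ β + kA`, `A ↦ A + 4kβ`)", stub
`stub_euclidGame`).

Cycle 7 of the line derives the transitivity of the group generated by the level-2 elementary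
moves on the primitive vectors of a skew lattice with odd first coordinate ("unimodular
transitivity").  In coordinates the squares of the two basic transvections act on a pair `(A, β)`
(`A` odd) by `β ↦ β + k A` and `A ↦ A + 4 k β`, and the transitivity statement reduces to the
following purely arithmetic fact, proved here:

* `localTubeSpan_euclidGame` — if a predicate `P` on `ℤ × ℤ` is stable under `β ↦ β + k A` and
  under `A ↦ A + 4 k β`, and holds at `(1, 0)` and `(-1, 0)`, then it holds at every pair `(A, β)`
  with `A` odd and `gcd(A, β) = 1`.

Proof (a Euclidean descent on `|A| + |β|`): both moves are invertible (`k ↦ -k`), preserve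
coprimality and the parity of `A`.  If `β = 0`, coprimality forces `A = ±1`.  If `β ≠ 0`, then
`|A| ≠ 2|β|` by parity; when `|A| > 2|β|` the move `A ↦ A ∓ 4β` strictly decreases `|A|`, and when
`|A| < 2|β|` the move `β ↦ β ∓ A` strictly decreases `|β|` (`A ≠ 0` being odd), so the induction
hypothesis applies to the new pair and the inverse move brings `P` back.  Mathlib only
(`IsCoprime.add_mul_right_left`, `IsCoprime.add_mul_right_right`, `Int.isUnit_iff`, `omega`);
no named facts; no `sorry`.
-/

-- `Summit.HodgeConjecture.HodgeConjecture.Theorems` is the mandated namespace (single-conjunct summit: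
-- Sub = Summit), which `linter.dupNamespace` flags on every declaration; the lakefile turns the
-- linter off tree-wide (weak option), restated here so stand-alone elaboration is warning-free too.
set_option linter.dupNamespace false

namespace Summit.HodgeConjecture.HodgeConjecture.Theorems

/-- **The Euclid game** (stub `stub_euclidGame` of the line `Sketch`, pure arithmetic).
Let `P` be a predicate on pairs of integers which is stable under the two elementary moves
`(A, β) ↦ (A, β + k A)` and `(A, β) ↦ (A + 4 k β, β)` (`k ∈ ℤ`) and holds at `(1, 0)` and at
`(-1, 0)`.  Then `P A β` holds for every odd `A` and every `β` coprime to `A`: a Euclidean descent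
on `|A| + |β|` — for `β ≠ 0` one has `|A| ≠ 2|β|` by parity, and `A ↦ A ∓ 4β` (if `|A| > 2|β|`)
or `β ↦ β ∓ A` (if `|A| < 2|β|`) strictly decreases `|A| + |β|` while preserving coprimality and
the parity of `A`; for `β = 0` coprimality forces `A = ±1`. [folklore] -/
theorem localTubeSpan_euclidGame (P : ℤ → ℤ → Prop)
    (h1 : ∀ A β k : ℤ, P A β → P A (β + k * A))
    (h2 : ∀ A β k : ℤ, P A β → P (A + 4 * k * β) β)
    (hone : P 1 0) (hneg : P (-1) 0)
    (A β : ℤ) (hA : Odd A) (hcop : IsCoprime A β) : P A β := by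
  -- Euclidean descent on `|A| + |β|`
  obtain ⟨n, hn⟩ : ∃ n : ℕ, A.natAbs + β.natAbs ≤ n := ⟨_, le_rfl⟩
  induction n generalizing A β with
  | zero =>
    -- `|A| + |β| = 0` forces `A = 0`, which is not odd
    have hA2 : A % 2 = 1 := Int.odd_iff.mp hA
    omega
  | succ n ih =>
    by_cases hβ : β = 0
    · -- `gcd(A, 0) = 1` forces `A = ±1`
      subst hβ
      rcases Int.isUnit_iff.mp (isCoprime_zero_right.mp hcop) with rfl | rfl
      exacts [hone, hneg]
    · have hA2 : A % 2 = 1 := Int.odd_iff.mp hA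
      -- one elementary move (with `k = ±1`) strictly decreases `|A| + |β|`
      have hmove : (∃ k : ℤ, (A + 4 * k * β).natAbs < A.natAbs) ∨
          (∃ k : ℤ, (β + k * A).natAbs < β.natAbs) := by
        rcases le_or_gt 0 A with hA0 | hA0 <;> rcases le_or_gt 0 β with hb0 | hb0 <;>
          rcases lt_or_ge (2 * β.natAbs) A.natAbs with hc | hc
        exacts [Or.inl ⟨-1, by omega⟩, Or.inr ⟨-1, by omega⟩, Or.inl ⟨1, by omega⟩,
          Or.inr ⟨1, by omega⟩, Or.inl ⟨1, by omega⟩, Or.inr ⟨1, by omega⟩,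
          Or.inl ⟨-1, by omega⟩, Or.inr ⟨-1, by omega⟩]
      rcases hmove with ⟨k, hk⟩ | ⟨k, hk⟩
      · -- move `A ↦ A + 4kβ`, apply the induction hypothesis, and move back with `-k`
        have hP : P (A + 4 * k * β) β :=
          ih (A + 4 * k * β) β (hA.add_even ⟨2 * k * β, by ring⟩)
            (hcop.add_mul_right_left (4 * k)) (by omega)
        have e : A + 4 * k * β + 4 * (-k) * β = A := by ring
        have hP' := h2 _ _ (-k) hP
        rwa [e] at hP'
      · -- move `β ↦ β + kA`, apply the induction hypothesis, and move back with `-k`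
        have hP : P A (β + k * A) :=
          ih A (β + k * A) hA (hcop.add_mul_right_right k) (by omega)
        have e : β + k * A + (-k) * A = β := by ring
        have hP' := h1 _ _ (-k) hP
        rwa [e] at hP'

end Summit.HodgeConjecture.HodgeConjecture.Theorems
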